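import Summits.CriticalPhenomena.PercolationContinuityZ3.Theorems.PercNearOneGluingNoHeavyLowerTailSunflowerWeakUniversal
import HarnessLib

/-!
# `NoHeavyLowerTail` (crux stmt-CriticalPhenomena-4575), abstract sunflower cubic: (RES0′) ∀n IS A CAPPED PENDANT LEMMA —
# the exact reduction of the open all-`n` statement to the 5-parameter, 3-coordinate statement `CappedPendant`

Support file (seat `prim-ineq-prove-1` gen 61; `--supports stmt-CriticalPhenomena-4575`).  No `sorry`, no named facts; one
definition (`CappedPendant`, a parametrised `Prop`, conjecture-shaped) used only as a hypothesis.
Memo: run/shared/lean/prim/prim-ineq-prove-1/FINDING-CPL-prove1-g61.md §2–§4.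

Dictionary as in `…SunflowerWeakUniversal`: `G = στ + σ(1−τ)h̃ + (1−σ)τȲ + (1−σ)(1−τ)g̃` with `h̃ = sh + (1−s)α₀₀`,
`g̃ = sg + (1−s)α₀₀`, floors `b = b_Ȳ`, `β = sα₁₁ + (1−s)α₀₀`, cap `V = s + (1−s)α₀₀` (the frozen `w = 0` cells never rise), budgets
`∏ Ȳ ≤ b^(n−1)`, `∏ h̃ ≤ β^(n−1)V`, `∏ H̃ ≤ ((1−σ)b + σβ)^(n−1)V`, links `g̃ ≤ Ȳ` (`g ≤ k`), `g̃ ≤ h̃` (`g ≤ h`).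
* `CappedPendant s t b β V`: the pendant analytic lemma WITH the cap `vv ≤ V`, the link `m ≤ vv`, the sharpened budgets
  `β^(n−1)V`, `a₀^(n−1)V` and the sharpened conclusion `c^(n−1)(t + (1−t)V)`;
* `cappedPendant_one`: at `V = 1` it IS `Pendant.pendant_prod_le` (kernel, gen 49);
* `res0_of_cappedPendant`: `CappedPendant σ τ b_Ȳ β̃ V` implies the sharp (RES0′) `∏ G_j ≤ (g*)^(n−1)·a` for every `n` and every
  family (budgets `(BȲ), (Bh), (BH)`, links `g ≤ k`, `g ≤ h`, caps `y, k, h ≤ 1`; no `(By)`, `(Bk)`).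
So the open all-`n` problem is a statement about THREE numbers per petal and FIVE parameters `(s,t,b,β,V)`, `0 < b ≤ β ≤ V ≤ 1`;
in these coordinates the leverage dwarf is the petal `(u,vv,m) = (β,β,β)`, the `h`-petal is `(b,V′,b)`, hubs are `(u,β,b)`
(memo §3–§4: numerics — no violation found; the fully merged two-class endgame of the pendant proof is false by `O(st)` when
`V < 1`, the truth being saved by the merge defects of the dwarf pack, so a proof must not merge the `u`-heavy class).
-/

noncomputable section

namespace Summit.CriticalPhenomena.PercolationContinuityZ3.Theorems.SunflowerPartition

namespace SafeCalc

namespace LinkedCurrency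

open Finset

variable {κ : Type*}

/-- **The capped pendant lemma (statement).**  Coins `s, t`; floors `b` (for `u` and `m`) and `β` (for `vv`); cap `V` for `vv`.
For every `n` and all petals `(u_j, vv_j, m_j)` with `b ≤ u_j ≤ 1`, `β ≤ vv_j ≤ V`, `b ≤ m_j ≤ min(u_j, vv_j)` and the budgets
`∏ u_j ≤ b^(n−1)`, `∏ vv_j ≤ β^(n−1)·V`, `∏ ((1−s)m_j + s vv_j) ≤ ((1−s)b + sβ)^(n−1)·V`:
`∏ (st + s(1−t)vv_j + (1−s)t u_j + (1−s)(1−t)m_j) ≤ (st + s(1−t)β + (1−s)b)^(n−1)·(t + (1−t)V)`.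
For `V = 1` this is `Pendant.pendant_prod_le` (`cappedPendant_one`); for `0 < b ≤ β ≤ V < 1` it is OPEN (numerically supported,
memo §3) and implies (RES0′) for all `n` (`res0_of_cappedPendant`). [conjecture-shaped hypothesis, this work] -/
def CappedPendant (s t b β V : ℝ) : Prop :=
  ∀ (n : ℕ) (u vv m : Fin n → ℝ), (∀ j, b ≤ u j) → (∀ j, u j ≤ 1) → (∀ j, β ≤ vv j) → (∀ j, vv j ≤ V) →
    (∀ j, b ≤ m j) → (∀ j, m j ≤ u j) → (∀ j, m j ≤ vv j) →
    ∏ j, u j ≤ b ^ (n - 1) → ∏ j, vv j ≤ β ^ (n - 1) * V →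
    ∏ j, ((1 - s) * m j + s * vv j) ≤ ((1 - s) * b + s * β) ^ (n - 1) * V →
    ∏ j, (s * t + s * (1 - t) * vv j + (1 - s) * t * u j + (1 - s) * (1 - t) * m j) ≤
      (s * t + s * (1 - t) * β + (1 - s) * b) ^ (n - 1) * (t + (1 - t) * V)

/-- **`V = 1`: the capped pendant lemma is the pendant lemma** (`Pendant.pendant_prod_le`, gen 49). [this work] -/
theorem cappedPendant_one {s t b β : ℝ} (hb : 0 < b) (hbβ : b ≤ β) (hs : 0 ≤ s) (hs1 : s ≤ 1) (ht : 0 ≤ t)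
    (ht1 : t ≤ 1) : CappedPendant s t b β 1 := by
  intro n u vv m hub _hu1 hvβ _hv1 hmb hmu _hmv hpu hpv hpg
  rw [mul_one] at hpv hpg
  have key := Pendant.pendant_prod_le hb hbβ hs hs1 ht ht1 u vv m hub hvβ hmb hmu hpu hpv hpg
  have h1 : t + (1 - t) * (1 : ℝ) = 1 := by ring
  rw [h1, mul_one]
  exact key

/-- **(RES0′) FOR ALL `n` FROM THE CAPPED PENDANT LEMMA.**  Coins `σ, s ∈ [0,1]` (`τ` any real), floors
`0 < α₀₀ ≤ α₀₁ ≤ α₁₁`;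
petals `j ∈ S` (nonempty) with `α₀₀ ≤ y_j ≤ 1`, `α₀₁ ≤ k_j ≤ 1`, `α₀₁ ≤ g_j ≤ min(k_j, h_j)`, `α₁₁ ≤ h_j ≤ 1`; budgets
`(BȲ)`, `(Bh)`, `(BH)` as in `res0_weak_universal`.  IF `CappedPendant σ τ b_Ȳ (sα₁₁+(1−s)α₀₀) (s+(1−s)α₀₀)` holds, then
`∏_S G_j ≤ (g*)^(|S|−1)·a` with `a = G(full) = τσ + (1−τ)(1−s)α₀₀ + τ(1−σ) + s(1−τ)` — the sharp (RES0′), for every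
number of petals, with no `(By)`, `(Bk)` hypothesis.  (The dictionary of `res0_weak_universal`; the caps `Ȳ ≤ 1`, `h̃ ≤ V`
come from `y, k, h ≤ 1`, the link `m ≤ vv` from `g ≤ h`, the capped budgets from `prod_wavg_le`.) [this work] -/
theorem res0_of_cappedPendant [DecidableEq κ] {τ σ s α00 α01 α11 : ℝ} (hσ0 : 0 ≤ σ)
    (hσ1 : σ ≤ 1) (hs0 : 0 ≤ s) (hs1 : s ≤ 1) (hα0 : 0 < α00) (h01 : α00 ≤ α01) (h11 : α01 ≤ α11)
    (hCPL : CappedPendant σ τ ((1 - s) * α00 + s * α01) (s * α11 + (1 - s) * α00) (s + (1 - s) * α00))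
    (S : Finset κ) (hS : S.Nonempty) (y k gc h : κ → ℝ)
    (hy : ∀ j ∈ S, α00 ≤ y j) (hy1 : ∀ j ∈ S, y j ≤ 1) (hk : ∀ j ∈ S, α01 ≤ k j) (hk1 : ∀ j ∈ S, k j ≤ 1)
    (hg : ∀ j ∈ S, α01 ≤ gc j) (hgk : ∀ j ∈ S, gc j ≤ k j) (hgh : ∀ j ∈ S, gc j ≤ h j) (hh : ∀ j ∈ S, α11 ≤ h j)
    (hh1 : ∀ j ∈ S, h j ≤ 1)
    (hBY : ∏ j ∈ S, ((1 - s) * y j + s * k j) ≤ ((1 - s) * α00 + s * α01) ^ (S.card - 1))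
    (hBh : ∏ j ∈ S, h j ≤ α11 ^ (S.card - 1))
    (hBH : ∏ j ∈ S, ((1 - σ) * gc j + σ * h j) ≤ ((1 - σ) * α01 + σ * α11) ^ (S.card - 1)) :
    ∏ j ∈ S, (τ * σ + (1 - τ) * (1 - s) * α00 + τ * (1 - σ) * ((1 - s) * y j + s * k j) +
        s * (1 - τ) * ((1 - σ) * gc j + σ * h j)) ≤
      (τ * σ + (1 - τ) * (1 - s) * α00 + τ * (1 - σ) * ((1 - s) * α00 + s * α01) +
        s * (1 - τ) * ((1 - σ) * α01 + σ * α11)) ^ (S.card - 1) *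
        (τ * σ + (1 - τ) * (1 - s) * α00 + τ * (1 - σ) + s * (1 - τ)) := by
  classical
  have hs' : 0 ≤ 1 - s := sub_nonneg.2 hs1
  have hσ' : 0 ≤ 1 - σ := sub_nonneg.2 hσ1
  have hα01 : 0 < α01 := hα0.trans_le h01
  have hα11 : 0 < α11 := hα01.trans_le h11
  set e := S.equivFin with he
  have mem : ∀ i : Fin S.card, ((e.symm i : S) : κ) ∈ S := fun i => (e.symm i).2
  set u : Fin S.card → ℝ := fun i => (1 - s) * y ((e.symm i : S) : κ) + s * k ((e.symm i : S) : κ) with hu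
  set vv : Fin S.card → ℝ := fun i => s * h ((e.symm i : S) : κ) + (1 - s) * α00 with hvv
  set m : Fin S.card → ℝ := fun i => s * gc ((e.symm i : S) : κ) + (1 - s) * α00 with hm
  set b : ℝ := (1 - s) * α00 + s * α01 with hb
  set β : ℝ := s * α11 + (1 - s) * α00 with hβ
  set V : ℝ := s + (1 - s) * α00 with hV
  have hbH : 0 < (1 - σ) * α01 + σ * α11 := by nlinarith
  have hBvv : ∏ i, vv i ≤ β ^ (S.card - 1) * V := by
    have h1 := prod_wavg_le hs0 hs1 hα0.le hα11 S hS h hh hBh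
    have h2 : ∏ i, vv i = ∏ j ∈ S, (s * h j + (1 - s) * α00) := by
      rw [hvv, ← prod_eq_prod_fin_equiv S (fun j => s * h j + (1 - s) * α00)]
    rw [h2, hβ, hV]; exact h1
  have hBg : ∏ i, ((1 - σ) * m i + σ * vv i) ≤ ((1 - σ) * b + σ * β) ^ (S.card - 1) * V := by
    have h1 := prod_wavg_le hs0 hs1 hα0.le hbH S hS (fun j => (1 - σ) * gc j + σ * h j)
      (fun j hj => by nlinarith [hg j hj, hh j hj]) hBH
    have h2 : ∏ i, ((1 - σ) * m i + σ * vv i) = ∏ j ∈ S, (s * ((1 - σ) * gc j + σ * h j) + (1 - s) * α00) := by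
      rw [hm, hvv, prod_eq_prod_fin_equiv S (fun j => s * ((1 - σ) * gc j + σ * h j) + (1 - s) * α00)]
      exact Fintype.prod_congr _ _ (fun i => by ring)
    have h3 : s * ((1 - σ) * α01 + σ * α11) + (1 - s) * α00 = (1 - σ) * b + σ * β := by rw [hb, hβ]; ring
    rw [h2, ← h3, hV]; exact h1
  have hBu : ∏ i, u i ≤ b ^ (S.card - 1) := by
    rw [hu, hb, ← prod_eq_prod_fin_equiv S (fun j => (1 - s) * y j + s * k j)]; exact hBY
  have key := hCPL S.card u vv m
    (fun i => by show b ≤ u i; rw [hb, hu]; nlinarith [hy _ (mem i), hk _ (mem i)])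
    (fun i => by show u i ≤ 1; rw [hu]; nlinarith [hy1 _ (mem i), hk1 _ (mem i)])
    (fun i => by show β ≤ vv i; rw [hβ, hvv]; nlinarith [hh _ (mem i)])
    (fun i => by show vv i ≤ V; rw [hV, hvv]; nlinarith [hh1 _ (mem i)])
    (fun i => by show b ≤ m i; rw [hb, hm]; nlinarith [hg _ (mem i)])
    (fun i => by show m i ≤ u i; rw [hm, hu]; nlinarith [hgk _ (mem i), hy _ (mem i)])
    (fun i => by show m i ≤ vv i; rw [hm, hvv]; nlinarith [hgh _ (mem i)])
    hBu hBvv hBg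
  have e1 : ∏ j ∈ S, (τ * σ + (1 - τ) * (1 - s) * α00 + τ * (1 - σ) * ((1 - s) * y j + s * k j) +
        s * (1 - τ) * ((1 - σ) * gc j + σ * h j)) =
      ∏ i : Fin S.card, (σ * τ + σ * (1 - τ) * vv i + (1 - σ) * τ * u i + (1 - σ) * (1 - τ) * m i) := by
    rw [prod_eq_prod_fin_equiv S]
    refine Fintype.prod_congr _ _ (fun i => ?_)
    rw [hu, hvv, hm]; ring
  rw [e1]
  refine key.trans (le_of_eq ?_)
  rw [hb, hβ, hV]; ring

end LinkedCurrency

end SafeCalc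

end Summit.CriticalPhenomena.PercolationContinuityZ3.Theorems.SunflowerPartition
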